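import Summits.HodgeConjecture.CorCM.Model.CMDominationOfRiemann
import Literature.AlgebraicGeometry.ComplexMultiplication.PrincipalModelOfCMOrder
import Mathlib.CategoryTheory.Preadditive.Biproducts
import HarnessLib

/-!
# COR-CM: the left-nested CM product `∏_j A_{(F,Θ_j)}` IS the finite biproduct `⨁_j A_{(F,Θ_j)}`, and
# every complex abelian variety of CM type is dominated by a biproduct of realisations of CM types of ONE
# Galois CM field — modulo Riemann's theorem only

Cell `pub-hodgecm2` (COR-CM = Hodge ladder stage 2), seat b18. The bridge `cmProdAV ⇝ ⨁` between the
domination toolkit of rows M14/M20 (`Domination.cmProdAV F h₃ n Θ`, a LEFT-NESTED binary product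
`(⋯((A_{Θ₀} × A_{Θ₁}) × A_{Θ₂}) ⋯) × A_{Θ_n}` of the chosen realisations of the codes `cmCode F (Θ j)`,
`Theorems/CorCMDominationCMProduct.lean`) and the finite BIPRODUCT `⨁ B` of the preadditive category
`AbelianVariety ℂ` on which André's theorem in product form is a kernel theorem
(`CorCM/AndreProductFormHolds.lean`, `AndreProductForm.mem_algebraicClasses_cmTypedProduct`, for
`B : Fin m → AbelianVariety ℂ` realisations `IsCMTypeRealisation (Φ i) (B i) (ι i) (θ i)` of CM types of
one Galois CM field). Everything here is a theorem (no `def`):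

* `nonempty_biproduct_iso_biprod_castSucc` — abstract: in a category with zero morphisms, finite and
  binary biproducts, `⨁_{j : Fin (n+1)} f j ≅ (⨁_{i : Fin n} f i.castSucc) ⊞ f (Fin.last n)` (the matrix
  calculus `biproduct.ι_π`; Mathlib has reindexing `biproduct.whiskerEquiv` and the `Σ`-type
  `biproductBiproductIso` but not this splitting);
* `nonempty_iso_biproduct_fin_one` — abstract: `f 0 ≅ ⨁_{j : Fin 1} f j`;
* `nonempty_cmProdAV_iso_biproduct` — `cmProdAV F h₃ n Θ ≅ ⨁ fun j => (cmRealisation h₃ (cmCode F (Θ j))).AV`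
  (induction on `n` with the tree's `AbelianVariety.biprodIsoProd : A ⊞ B ≅ A.prod B` and `prodCongrLeft`);
* `AVDominatedBy.biproduct_of_cmProdAV` / `cmProdAV_of_biproduct` — transport of domination across it;
* `cmTypeMap_symm_cmTypeMap`, `isCMTypeRealisation_cmCode` — the chosen realisation of the code
  `cmCode F Φ` READ OVER `F` (its `𝓞`- and `H¹`-actions pulled back along `cmCodeEquiv F Φ : F ≃+* (cmCode F Φ).E`)
  is a realisation of `(F; Φ)` itself (`IsCMTypeRealisation.transport` along `(cmCodeEquiv F Φ).symm`);
* `exists_avDominatedBy_biproduct_realisations` (over the binders `hd`, `hcor` and the GUARDED coding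
  hypothesis `hDomPos`) and `exists_avDominatedBy_biproduct_realisations_of_riemann` (on the displayed
  binders `hR`, `hU`, `h₃` of `HC_CM_of_PerLFace`): **for every complex abelian variety `A` of CM type there
  are a Galois CM field `F` with `6 ≤ [F:ℚ]`, CM types `Φ₀,…,Φ_n` of `F`, realisations
  `(B i, ι i, θ i)` of `(F; Φ i)` read on `H¹`, and homomorphisms `s : A → ⨁ B`, `π : ⨁ B → A`, `N ≠ 0`
  with `π ∘ s = [N]_A`** — Milne 2020's «we may suppose that `A` is a product `∏ A_Φ`» (proof of Thm. 1)
  / André 1992 p. 4 «quitte à remplacer `A` par une variété isogène … produit», for arbitrary `A`, KERNEL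
  modulo B02.

References: J. S. Milne, *Hodge classes on abelian varieties* (2020), proof of Theorem 1 (reduction to a
product of `A_Φ`'s over one Galois CM field); Y. André, *Une remarque à propos des cycles de Hodge de type
CM*, Progr. Math. 102 (1992), p. 4; D. Mumford, *Abelian Varieties* (1970), §19 (`Hom(∏ Aᵢ, C) = ⊕ Hom`,
Poincaré complete reducibility); G. Shimura, *Abelian Varieties with Complex Multiplication and Modular
Functions* (1998), §6.1 Corollary of Theorem 2, §6.2 Theorem 3; P. Deligne, J. S. Milne, LNM 900 (1982),
Thm. 6.20 (Riemann).
-/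

noncomputable section

open CategoryTheory CategoryTheory.Limits NumberField
open Literature.AlgebraicGeometry.Motives Literature.AlgebraicGeometry.HodgeTheory
open Literature.AlgebraicGeometry.ComplexMultiplication Literature.AlgebraicGeometry.Milne1999
open Literature.NumberTheory.Automorphic
open Literature.NumberTheory.Automorphic.PicardCM (CMCode cmRealisation BallQuotientUniformisedDatum
  CMAbelianVarietyRealised)

namespace Summit.HodgeConjecture.CorCM.Domination

/-! ### Abstract: splitting off the last summand of a biproduct indexed by `Fin (n+1)` -/

section Abstract

universe v u

variable {C : Type u} [Category.{v} C] [Preadditive C] [HasFiniteBiproducts C] [HasBinaryBiproducts C]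

/-- **Splitting off the last summand**: `⨁_{j : Fin (n+1)} f j ≅ (⨁_{i : Fin n} f (castSucc i)) ⊞ f (last n)`
in any preadditive category with finite and binary biproducts — the maps are the obvious matrices of
`biproduct.π` / `biproduct.ι`, the identities `hom ≫ inv = 𝟙` = `biproduct.total` split by
`Fin.sum_univ_castSucc`, `inv ≫ hom = 𝟙` = the Kronecker calculus `biproduct.ι_π` with `castSucc`
injective and `castSucc i ≠ last n`. [folklore] -/
theorem nonempty_biproduct_iso_biprod_castSucc (n : ℕ) (f : Fin (n + 1) → C) :
    Nonempty (⨁ f ≅ (⨁ fun i : Fin n => f i.castSucc) ⊞ f (Fin.last n)) := by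
  classical
  refine ⟨{ hom := biprod.lift (biproduct.lift fun i : Fin n => biproduct.π f i.castSucc)
              (biproduct.π f (Fin.last n))
            inv := biprod.desc (biproduct.desc fun i : Fin n => biproduct.ι f i.castSucc)
              (biproduct.ι f (Fin.last n))
            hom_inv_id := ?_
            inv_hom_id := ?_ }⟩
  · rw [biprod.lift_desc, biproduct.lift_desc, ← biproduct.total, Fin.sum_univ_castSucc]
  · refine biprod.hom_ext' _ _ (biprod.hom_ext _ _ ?_ ?_) (biprod.hom_ext _ _ ?_ ?_)
    · rw [biprod.inl_desc_assoc, Category.assoc, biprod.lift_fst, Category.comp_id, biprod.inl_fst]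
      refine biproduct.hom_ext' _ _ fun i => biproduct.hom_ext _ _ fun i' => ?_
      rw [biproduct.ι_desc_assoc, Category.assoc, biproduct.lift_π, biproduct.ι_π, Category.comp_id,
        biproduct.ι_π]
      by_cases h : i = i'
      · subst h
        simp
      · rw [dif_neg h, dif_neg fun h' => h (Fin.castSucc_injective n h')]
    · rw [biprod.inl_desc_assoc, Category.assoc, biprod.lift_snd, Category.comp_id, biprod.inl_snd]
      refine biproduct.hom_ext' _ _ fun i => ?_
      rw [biproduct.ι_desc_assoc, biproduct.ι_π, dif_neg (Fin.castSucc_lt_last i).ne, comp_zero]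
    · rw [biprod.inr_desc_assoc, Category.assoc, biprod.lift_fst, Category.comp_id, biprod.inr_fst]
      refine biproduct.hom_ext _ _ fun i' => ?_
      rw [Category.assoc, biproduct.lift_π, biproduct.ι_π, dif_neg (Fin.castSucc_lt_last i').ne',
        zero_comp]
    · rw [biprod.inr_desc_assoc, Category.assoc, biprod.lift_snd, Category.comp_id, biprod.inr_snd,
        biproduct.ι_π_self]

omit [Preadditive C] [HasBinaryBiproducts C] in
/-- A biproduct indexed by `Fin 1` is its only summand: `f 0 ≅ ⨁_{j : Fin 1} f j` (`biproduct.ι f 0`,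
`biproduct.π f 0`). [folklore] -/
theorem nonempty_iso_biproduct_fin_one [HasZeroMorphisms C] [HasFiniteBiproducts C] (f : Fin 1 → C) :
    Nonempty (f 0 ≅ ⨁ f) := by
  classical
  refine ⟨{ hom := biproduct.ι f 0
            inv := biproduct.π f 0
            hom_inv_id := biproduct.ι_π_self f 0
            inv_hom_id := ?_ }⟩
  refine biproduct.hom_ext' _ _ fun j => biproduct.hom_ext _ _ fun j' => ?_
  obtain rfl : j = 0 := Subsingleton.elim _ _
  obtain rfl : j' = 0 := Subsingleton.elim _ _
  rw [biproduct.ι_π_self_assoc, Category.comp_id]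

end Abstract

/-! ### The left-nested CM product is the biproduct of its factors -/

section CMProd

variable (F : Type) [Field F] [NumberField F] [IsCMField F]

/-- **`∏_{j ≤ n} A_{(F,Θ_j)} ≅ ⨁_{j ≤ n} A_{(F,Θ_j)}`**: the left-nested binary product `cmProdAV F h₃ n Θ` of
the chosen realisations of the codes `cmCode F (Θ j)` is isomorphic, in `AbelianVariety ℂ`, to their finite
biproduct. Induction on `n`: `cmProdAV (n+1) Θ = cmProdAV n (Θ ∘ castSucc) × A_{Θ last}`
(`cmProdAV_succ`) `≅ (⨁_{Fin (n+1)} …) × A_{Θ last}` (`prodCongrLeft`) `≅ (⨁ …) ⊞ A_{Θ last}`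
(`AbelianVariety.biprodIsoProd`) `≅ ⨁_{Fin (n+2)} …` (`nonempty_biproduct_iso_biprod_castSucc`).
[cite: MumfordAV1970, §19] -/
theorem nonempty_cmProdAV_iso_biproduct (h₃ : CMAbelianVarietyRealised) (n : ℕ)
    (Θ : Fin (n + 1) → CMType F) :
    Nonempty (cmProdAV F h₃ n Θ ≅ ⨁ fun j => (cmRealisation h₃ (cmCode F (Θ j))).AV) := by
  induction n with
  | zero => exact nonempty_iso_biproduct_fin_one (fun j => (cmRealisation h₃ (cmCode F (Θ j))).AV)
  | succ n ih =>
    obtain ⟨e⟩ := ih (fun i => Θ i.castSucc)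
    obtain ⟨s⟩ := nonempty_biproduct_iso_biprod_castSucc (C := AbelianVariety ℂ) (n + 1)
      (fun j => (cmRealisation h₃ (cmCode F (Θ j))).AV)
    rw [cmProdAV_succ]
    exact ⟨prodCongrLeft e _ ≪≫ (AbelianVariety.biprodIsoProd _ _).symm ≪≫ s.symm⟩

variable {F}

/-- Domination by the left-nested product ⟹ domination by the biproduct. [cite: MumfordAV1970, §19] -/
theorem AVDominatedBy.biproduct_of_cmProdAV {h₃ : CMAbelianVarietyRealised} {A : AbelianVariety ℂ} {n : ℕ}
    {Θ : Fin (n + 1) → CMType F}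
    (h : AVDominatedBy A (cmProdAV F h₃ n Θ)) :
    AVDominatedBy A (⨁ fun j => (cmRealisation h₃ (cmCode F (Θ j))).AV) := by
  obtain ⟨e⟩ := nonempty_cmProdAV_iso_biproduct F h₃ n Θ
  exact h.of_iso_right e

/-- Domination by the biproduct ⟹ domination by the left-nested product. [cite: MumfordAV1970, §19] -/
theorem AVDominatedBy.cmProdAV_of_biproduct {h₃ : CMAbelianVarietyRealised} {A : AbelianVariety ℂ} {n : ℕ}
    {Θ : Fin (n + 1) → CMType F}
    (h : AVDominatedBy A (⨁ fun j => (cmRealisation h₃ (cmCode F (Θ j))).AV)) :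
    AVDominatedBy A (cmProdAV F h₃ n Θ) := by
  obtain ⟨e⟩ := nonempty_cmProdAV_iso_biproduct F h₃ n Θ
  exact h.of_iso_right e.symm

end CMProd

/-! ### The chosen realisation of `cmCode F Φ`, read over `F` -/

section ReadOverF

/-- Transporting a CM type along `e` and back along `e⁻¹` is the identity. [folklore] -/
theorem cmTypeMap_symm_cmTypeMap {L E : Type} [Field L] [Field E] (e : L ≃+* E) (Φ : CMType L) :
    CMCode.cmTypeMap e.symm (CMCode.cmTypeMap e Φ) = Φ := by
  refine Subtype.ext (Set.ext fun σ => ?_)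
  change (σ.comp e.symm.toRingHom).comp e.toRingHom ∈ Φ.1 ↔ σ ∈ Φ.1
  have hσ : (σ.comp e.symm.toRingHom).comp e.toRingHom = σ := RingHom.ext fun x => by simp
  rw [hσ]

variable (F : Type) [Field F] [NumberField F] [IsCMField F]

/-- The CM type of the code `cmCode F Φ` is `Φ` transported along `cmCodeEquiv F Φ` (by construction).
[folklore] -/
theorem cmCode_Φ (Φ : CMType F) : (cmCode F Φ).Φ = CMCode.cmTypeMap (cmCodeEquiv F Φ) Φ := rfl

/-- **The chosen realisation of the code `cmCode F Φ`, READ OVER `F`, is a realisation of `(F; Φ)`**: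
`(cmRealisation h₃ (cmCode F Φ)).AV` with the `𝓞_F`-action `ι ∘ 𝓞(cmCodeEquiv F Φ)` and the `H¹`-action
`θ ∘ cmCodeEquiv F Φ` satisfies `IsCMTypeRealisation Φ` — the tree's `cmRealisation_isCMTypeRealisation`
(a realisation of `((cmCode F Φ).E; Φ^{e})`, `e = cmCodeEquiv F Φ`) transported back along `e⁻¹`
(`IsCMTypeRealisation.transport`, `cmTypeMap e⁻¹ (cmTypeMap e Φ) = Φ`).
[cite: Shimura1998, §5.2 (type `(F; {φ_i})`) and §6.2 Theorem 3] -/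
theorem isCMTypeRealisation_cmCode (h₃ : CMAbelianVarietyRealised) (Φ : CMType F) :
    IsCMTypeRealisation Φ (cmRealisation h₃ (cmCode F Φ)).AV
      ((cmRealisation h₃ (cmCode F Φ)).ι.comp (RingOfIntegers.mapRingEquiv (cmCodeEquiv F Φ)).toRingHom)
      ((cmRealisation h₃ (cmCode F Φ)).θ.comp (cmCodeEquiv F Φ).toRingHom) := by
  have h := (cmRealisation_isCMTypeRealisation h₃ (cmCode F Φ)).transport (cmCodeEquiv F Φ).symm
  rw [cmCode_Φ, cmTypeMap_symm_cmTypeMap] at h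
  exact h

end ReadOverF

/-! ### Every CM abelian variety is dominated by a biproduct of realisations over one Galois CM field -/

section Headline

/-- **Every complex abelian variety of CM type is dominated by a finite biproduct `⨁_i B_i` of
realisations `(B_i, ι_i, θ_i)` of CM types `Φ_i` of ONE Galois CM field `F` with `6 ≤ [F:ℚ]`**, over the
binders `hd` (Shimura 1998 §6.2 Thm. 3: isogenous power for an induced type), `hcor` (§6.1 Cor. of Thm. 2)
and the GUARDED coding hypothesis `hDomPos` (positive-dimensional CM `A` isogenous to a CM-flagged code):
`cmDominated_of_isOfCMType_all`, then `nonempty_cmProdAV_iso_biproduct` and `isCMTypeRealisation_cmCode`.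
[cite: Shimura1998, §5.1, §6.1 Corollary of Theorem 2 (p. 41), §6.2 Theorem 3 (pp. 41–43), §18.2 Lemma (ii)–(iii)]
[cite: Milne2020HodgeClassesAV, proof of Theorem 1 («we may suppose that A is a product»)] -/
theorem exists_avDominatedBy_biproduct_realisations (hU : BallQuotientUniformisedDatum)
    (h₃ : CMAbelianVarietyRealised) (hd : Shimura1998_Thm3_isogenousPower) (hcor : Shimura1998_Thm2_Cor)
    (hDomPos : ∀ A : AbelianVariety ℂ, 0 < A.dim → IsOfCMType A →
      ∃ (v : PicardCM.Var) (B : AbelianVariety ℂ), PicardCM.Var.IsCMAbelianVariety h₃ v ∧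
        B.X = PicardCM.Var.scheme hU h₃ v ∧ AbelianVariety.IsIsogenous A B)
    (A : AbelianVariety ℂ) (hCM : IsOfCMType A) :
    ∃ (F : Type) (_ : Field F) (_ : NumberField F) (_ : IsCMField F),
      IsGalois ℚ F ∧ 6 ≤ Module.finrank ℚ F ∧
        ∃ (n : ℕ) (B : Fin (n + 1) → AbelianVariety ℂ) (Φ : Fin (n + 1) → CMType F)
          (ι : ∀ i, 𝓞 F →+* End (B i)) (θ : ∀ i, F →+* Module.End ℂ (complexBetti (B i).X 1)),
          (∀ i, IsCMTypeRealisation (Φ i) (B i) (ι i) (θ i)) ∧ AVDominatedBy A (⨁ B) := by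
  obtain ⟨F, _, _, _, hG, h6, n, Θ, hdom⟩ := cmDominated_of_isOfCMType_all hU h₃ hd hcor hDomPos A hCM
  exact ⟨F, inferInstance, inferInstance, inferInstance, hG, h6, n,
    fun j => (cmRealisation h₃ (cmCode F (Θ j))).AV, Θ,
    fun j => (cmRealisation h₃ (cmCode F (Θ j))).ι.comp
      (RingOfIntegers.mapRingEquiv (cmCodeEquiv F (Θ j))).toRingHom,
    fun j => (cmRealisation h₃ (cmCode F (Θ j))).θ.comp (cmCodeEquiv F (Θ j)).toRingHom,
    fun j => isCMTypeRealisation_cmCode F h₃ (Θ j), hdom.biproduct_of_cmProdAV⟩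

/-- **Every complex abelian variety of CM type is dominated by a finite biproduct of realisations of CM
types of ONE Galois CM field of degree `≥ 6` — modulo Riemann's theorem only** (the displayed binders of
`HC_CM_of_PerLFace`: `hR : DeligneMilne1982_Thm_6_20_full` (row B02), the records `hU`, `h₃`; Shimura's
inputs from `thm3_isogenousPower_of_riemann hR h₃`, `thm2_cor_of_riemann hR`, the guarded coding from
`Model.hDomPos_of_riemann`). This is the reduction «we may suppose that `A` is a product of `A_Φ`'s over one
Galois CM field» of Milne 2020, proof of Thm. 1 (André 1992 p. 4), for ARBITRARY `A`: a Hodge class on `A`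
is algebraic as soon as its pull-back to `⨁ B` along `π` is (`π ∘ s = [N]_A`, `[N]^* = N^{2p}` on
`H^{2p}(A;ℚ)`). [cite: Milne2020HodgeClassesAV, proof of Theorem 1] [cite: Andre1992HodgeCM, p. 4]
[cite: Shimura1998, §6.1 Corollary of Theorem 2 (p. 41), §6.2 Theorem 3 (pp. 41–43)]
[cite: DeligneMilne1982Tannakian, §6 Thm. 6.20 (Riemann), print p. 212] -/
theorem exists_avDominatedBy_biproduct_realisations_of_riemann (hR : DeligneMilne1982_Thm_6_20_full)
    (hU : BallQuotientUniformisedDatum) (h₃ : CMAbelianVarietyRealised)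
    (A : AbelianVariety ℂ) (hCM : IsOfCMType A) :
    ∃ (F : Type) (_ : Field F) (_ : NumberField F) (_ : IsCMField F),
      IsGalois ℚ F ∧ 6 ≤ Module.finrank ℚ F ∧
        ∃ (n : ℕ) (B : Fin (n + 1) → AbelianVariety ℂ) (Φ : Fin (n + 1) → CMType F)
          (ι : ∀ i, 𝓞 F →+* End (B i)) (θ : ∀ i, F →+* Module.End ℂ (complexBetti (B i).X 1)),
          (∀ i, IsCMTypeRealisation (Φ i) (B i) (ι i) (θ i)) ∧ AVDominatedBy A (⨁ B) :=
  exists_avDominatedBy_biproduct_realisations hU h₃ (thm3_isogenousPower_of_riemann hR h₃)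
    (thm2_cor_of_riemann hR) (Model.hDomPos_of_riemann hR hU h₃) A hCM

end Headline

end Summit.HodgeConjecture.CorCM.Domination

end
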